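import Literature.NumberTheory.Automorphic.ShimuraCurveCartanLevel
import Literature.NumberTheory.Automorphic.ShimuraParametrizationSplitCaseProofs
import Literature.NumberTheory.Automorphic.ShimuraCurveDegreeFormulaProofs
import Literature.NumberTheory.Automorphic.FundamentalDomainCosetUnfolding
import HarnessLib

/-!
# Crux 23422 `EulerHalvesAtThreeResidualUpperBound`, line `cartan`, stub (F2⁰) `CartanDegree.CartanEmptyDegreeIndep`:
# transport of Cartan parametrisation data along `τ ↦ g τ` between two conjugate presentations

Seat `bsd-stepL-cartan-f20` (AUTOFILL #2 row (2); `--supports stmt-BirchSwinnertonDyer-23422`; helper file 2). For two Cartan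
data `X₁, X₂ : CartanLevelCurveData D M C` whose presentations are conjugate — a real matrix `m` is `ι₁(x)` with `x ∈ O₁` iff
`g m g⁻¹` is `ι₂(y)` with `y ∈ O₂`, for a fixed `g ∈ GL₂(ℝ)` with `det g > 0` — every `CartanParametrizationData X₂ W` yields a
`CartanParametrizationData X₁ W` OF THE SAME DEGREE (`exists_cartanParametrizationData_deg_eq`): same lattice and
uniformisation, form `F₂ ∣[2] g` (Mathlib `CuspForm.translate`) on `Γ₁ = g⁻¹ Γ₂ g` (`conjAct_inv_smul_Gamma_eq`), base point
`g⁻¹ τ₀`; the segment integrals (`segmentIntegral_slash_inv_smul`: `∫_{g⁻¹z}^w (F ∣[2] g) = ∫_{z}^{gw} F`), the periods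
(`hasPeriodsIn_slash_of_conjAct_eq`), the Hecke operators (`heckeFun_eq_heckeFun_slash`: `T_n^{(1)}(F₂ ∣ g) = (T_n^{(2)} F₂) ∣ g`, by the
bijection `Γ₁ a ↦ Γ₂ (g a g⁻¹)` of coset spaces, `mem_heckeSet_iff_conj`) and the orbit-fibre counts
(`card_orbitFibre_eq_of_conjAct_eq`, bijection `Γ₁ τ ↦ Γ₂ (g τ)`) all transport. The slash lemmas of §1 re-derive (in the shapes consumed here) the content of
`hasDerivAt_comp_smul_of_hasDerivAt`, `segmentIntegral_slash_eq`, `hasPeriodsIn_slash` of the tree module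
`ShimuraParametrizationSplitCaseConverseProofs`, which has no hub olean at the time of writing;
the Hecke and orbit arguments follow the tree's `ShimuraCurveData.heckeFun_eq_sum_of_conj` / `card_orbitFibre_eq_of_conj`
(`ShimuraParametrizationSplitCaseProofs`, the case `Γ₂ = Γ₀(M)`), here for two arbitrary norm-one groups.

HONEST FRAMING: helper lemmas (pure transport; valid for every `C`); no statement item is closed; nothing about `Ш`; BSD is
proved for no curve. References: [cite: PastenShimura2024, §4.8 p. 15 (Hecke action) and §5.3 p. 17]
[cite: KohenPacetti2016, §2 (arXiv:1403.7801v3 pp. 7–8)] [cite: DiamondShurman2005, Prop. 5.2.1 and Exercise 5.1.3].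
-/

set_option linter.dupNamespace false
set_option autoImplicit false

noncomputable section

open scoped MatrixGroups ModularForm Pointwise
open UpperHalfPlane ConjAct

namespace Summit.BirchSwinnertonDyer.BirchSwinnertonDyer.Theorems.CartanDegree

open Literature.NumberTheory.Automorphic

/-! ## §1 Slash transport of segment integrals and periods (weight `2`, `det g > 0`) -/

section Slash

variable {Γ : Subgroup (GL (Fin 2) ℝ)}

/-- **`∫_{g⁻¹ z}^{w} (F ∣[2] g) = ∫_{z}^{g w} F`** for a weight-`2` form `F` and `det g > 0` (substitution `u = g τ`: if `G` is a
holomorphic primitive of `F` then `τ ↦ G(g τ)` is one of `F ∣[2] g`, as `d(gτ)/dτ = det g / j(g,τ)²`; both sides are differences of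
values of `G`). The statement shape is the one consumed below (base point moved by `g⁻¹`); the chain rule and the plain form
`∫_z^w (F ∣[2] g) = ∫_{gz}^{gw} F` are the tree's `hasDerivAt_comp_smul_of_hasDerivAt` / `segmentIntegral_slash_eq`
(module `ShimuraParametrizationSplitCaseConverseProofs`, no hub olean at the time of writing — hence re-derived inline here).
-- adapted from Literature/NumberTheory/Automorphic/ShimuraParametrizationSplitCaseConverseProofs.lean
[folklore] -/
theorem segmentIntegral_slash_inv_smul (F : CuspForm Γ 2) {g : GL (Fin 2) ℝ} (hg : 0 < g.det.val)
    (z w : ℍ) : segmentIntegral (⇑F ∣[(2 : ℤ)] g) (g⁻¹ • z) w = segmentIntegral F z (g • w) := by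
  obtain ⟨G, hG⟩ := exists_hasDerivAt_primitive F
  have hg' : 0 < g.val.det := by rwa [← Matrix.GeneralLinearGroup.val_det_apply]
  -- chain rule: `v ↦ G (g v)` is a primitive of `F ∣[2] g`
  have hG' : ∀ u : ℂ, 0 < u.im →
      HasDerivAt (fun v : ℂ => G ((g • ofComplex v : ℍ) : ℂ)) ((CuspForm.translate F g) (ofComplex u)) u := by
    intro u hu
    set τ : ℍ := ofComplex u with hτdef
    have hτ : (τ : ℂ) = u := by rw [hτdef, ofComplex_apply_of_im_pos hu]
    rw [← hτ]
    have h1 : HasDerivAt (fun v : ℂ => ((g • ofComplex v : ℍ) : ℂ)) ((g.val.det : ℂ) / denom g τ ^ 2) τ :=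
      (UpperHalfPlane.hasStrictDerivAt_smul hg' τ).hasDerivAt
    have h2 : HasDerivAt G (F (ofComplex ((g • ofComplex (τ : ℂ) : ℍ) : ℂ))) ((g • ofComplex (τ : ℂ) : ℍ) : ℂ) :=
      hG _ (g • ofComplex (τ : ℂ)).im_pos
    have h3 := h2.comp (τ : ℂ) h1
    simp only [ofComplex_apply] at h3
    refine h3.congr_deriv ?_
    show _ = (⇑F ∣[(2 : ℤ)] g) τ
    rw [ModularForm.slash_apply, σ_apply_of_det_pos hg, abs_of_pos hg, Matrix.GeneralLinearGroup.val_det_apply]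
    have hd : denom g τ ≠ 0 := denom_ne_zero g τ
    rw [show (2 : ℤ) - 1 = 1 by norm_num, zpow_one, zpow_neg, zpow_two]
    field_simp
  have h1 : segmentIntegral (⇑F ∣[(2 : ℤ)] g) (g⁻¹ • z) w =
      G ((g • ofComplex (w : ℂ) : ℍ) : ℂ) - G ((g • ofComplex ((g⁻¹ • z : ℍ) : ℂ) : ℍ) : ℂ) :=
    segmentIntegral_eq_sub (CuspForm.translate F g) hG' (g⁻¹ • z) w
  rw [segmentIntegral_eq_sub F hG z (g • w), h1]
  simp only [ofComplex_apply, smul_inv_smul]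

/-- **Periods transport along conjugation**: if `g⁻¹ Γ₂ g = Γ₁`, `det g > 0`, and the periods of `F ∈ S₂(Γ₂)` lie in `Λ`,
then the periods of `F ∣[2] g` on `Γ₁` lie in `Λ` (`∫_z^{γz} (F ∣[2] g) = ∫_{gz}^{(gγg⁻¹)(gz)} F`). (The tree's `hasPeriodsIn_slash`,
module `ShimuraParametrizationSplitCaseConverseProofs` without hub olean at the time of writing, is the same with `Γ₁` spelled
`g⁻¹ Γ₂ g`.) [folklore] -/
theorem hasPeriodsIn_slash_of_conjAct_eq {Γ₁ Γ₂ : Subgroup (GL (Fin 2) ℝ)} {g : GL (Fin 2) ℝ}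
    (hΓ : toConjAct g⁻¹ • Γ₂ = Γ₁) (F : CuspForm Γ₂ 2) (hg : 0 < g.det.val)
    {Λ : Set ℂ} (hF : HasPeriodsIn Γ₂ F Λ) : HasPeriodsIn Γ₁ (⇑F ∣[(2 : ℤ)] g) Λ := by
  intro γ hγ z
  rw [← hΓ, mem_conjAct_inv_smul_iff] at hγ
  have h := segmentIntegral_slash_inv_smul F hg (g • z) (γ • z)
  rw [inv_smul_smul] at h
  rw [h]
  have e : g • γ • z = (g * γ * g⁻¹) • (g • z) := by
    simp only [mul_smul, inv_smul_smul]
  rw [e]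
  exact hF _ hγ _

/-- **Orbit spaces of conjugate groups.** If `g⁻¹ Γ₂ g = Γ₁` then `Γ₁ τ ↦ Γ₂ (g τ)` is a bijection `Γ₁∖ℍ → Γ₂∖ℍ`; hence
for maps `G`, `Ψ` on `ℍ` with `G(τ) = Ψ(g τ)` the number of `Γ₁`-orbits meeting `G⁻¹(P)` equals the number of `Γ₂`-orbits
meeting `Ψ⁻¹(P)`. (The tree's `ShimuraCurveData.card_orbitFibre_eq_of_conj` is the case `Γ₂ = Γ₀(M)`.) [folklore] -/
theorem card_orbitFibre_eq_of_conjAct_eq {Γ₁ Γ₂ : Subgroup (GL (Fin 2) ℝ)} {g : GL (Fin 2) ℝ}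
    (hΓ : toConjAct g⁻¹ • Γ₂ = Γ₁) {A : Type*} (Ψ G : ℍ → A) (hG : ∀ τ, G τ = Ψ (g • τ)) (P : A) :
    Nat.card {y : MulAction.orbitRel.Quotient Γ₁ ℍ // ∃ τ : ℍ,
        (Quotient.mk _ τ : MulAction.orbitRel.Quotient Γ₁ ℍ) = y ∧ G τ = P} =
      Nat.card {y : MulAction.orbitRel.Quotient Γ₂ ℍ // ∃ τ : ℍ,
        (Quotient.mk _ τ : MulAction.orbitRel.Quotient Γ₂ ℍ) = y ∧ Ψ τ = P} := by
  have hmem : ∀ γ : GL (Fin 2) ℝ, γ ∈ Γ₁ ↔ g * γ * g⁻¹ ∈ Γ₂ := by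
    intro γ
    rw [← hΓ, mem_conjAct_inv_smul_iff]
  have hcompat : ∀ τ₁ τ₂ : ℍ, MulAction.orbitRel Γ₁ ℍ τ₁ τ₂ →
      MulAction.orbitRel Γ₂ ℍ (g • τ₁) (g • τ₂) := by
    rintro τ₁ τ₂ ⟨⟨γ, hγ⟩, rfl⟩
    refine ⟨⟨g * γ * g⁻¹, (hmem γ).mp hγ⟩, ?_⟩
    change (g * γ * g⁻¹) • (g • τ₂) = g • ((⟨γ, hγ⟩ : Γ₁) • τ₂)
    rw [Subgroup.mk_smul, mul_smul, mul_smul, inv_smul_smul]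
  let ψ : MulAction.orbitRel.Quotient Γ₁ ℍ → MulAction.orbitRel.Quotient Γ₂ ℍ :=
    Quotient.map' (fun τ : ℍ => g • τ) hcompat
  have hψ_mk : ∀ τ : ℍ, ψ (Quotient.mk _ τ) = Quotient.mk _ (g • τ) := fun τ => rfl
  have hψ_inj : Function.Injective ψ := by
    intro y₁ y₂
    induction y₁ using Quotient.inductionOn with
    | h τ₁ =>
      induction y₂ using Quotient.inductionOn with
      | h τ₂ =>
        intro heq
        rw [hψ_mk, hψ_mk] at heq
        obtain ⟨⟨γ, hγ⟩, hγτ⟩ := Quotient.exact heq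
        apply Quotient.sound
        refine ⟨⟨g⁻¹ * γ * g, (hmem _).mpr (by simpa only [← mul_assoc, mul_inv_cancel, one_mul,
          mul_inv_cancel_right] using hγ)⟩, ?_⟩
        change (g⁻¹ * γ * g) • τ₂ = τ₁
        have hγτ' : γ • (g • τ₂) = g • τ₁ := hγτ
        rw [mul_smul, mul_smul, hγτ', inv_smul_smul]
  have hψ_surj : Function.Surjective ψ := by
    intro y
    induction y using Quotient.inductionOn with
    | h τ => exact ⟨Quotient.mk _ (g⁻¹ • τ), by rw [hψ_mk, smul_inv_smul]⟩
  refine Nat.card_congr ((Equiv.ofBijective ψ ⟨hψ_inj, hψ_surj⟩).subtypeEquiv fun y => ?_)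
  induction y using Quotient.inductionOn with
  | h τ₁ =>
    rw [Equiv.ofBijective_apply]
    constructor
    · rintro ⟨τ, hτ, hGτ⟩
      refine ⟨g • τ, ?_, by rw [← hG, hGτ]⟩
      rw [← hψ_mk, hτ]
    · rintro ⟨τ', hτ', hΨ⟩
      refine ⟨g⁻¹ • τ', hψ_inj ?_, by rw [hG, smul_inv_smul, hΨ]⟩
      rw [hψ_mk, smul_inv_smul, hτ', hψ_mk]

end Slash

/-! ## §2 Transport of Cartan parametrisation data between two conjugate presentations -/

section Transport

variable {D M : ℕ} {C : Finset ℕ} (X₁ X₂ : CartanLevelCurveData D M C) {g : GL (Fin 2) ℝ}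
  (H : ∀ m : Matrix (Fin 2) (Fin 2) ℝ, (∃ x ∈ X₁.O, X₁.ι x = m) ↔
    ∃ x ∈ X₂.O, X₂.ι x = (g : Matrix (Fin 2) (Fin 2) ℝ) * m * ((g⁻¹ : GL (Fin 2) ℝ) : Matrix (Fin 2) (Fin 2) ℝ))

include H in
/-- **The groups are conjugate**: `ι₂(O₂) = g ι₁(O₁) g⁻¹` gives `g⁻¹ Γ₂ g = Γ₁` for `Γᵢ = ιᵢ(Oᵢ¹)`. [folklore] -/
theorem conjAct_inv_smul_Gamma_eq : toConjAct g⁻¹ • X₂.Gamma = X₁.Gamma := by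
  ext γ
  rw [mem_conjAct_inv_smul_iff, CartanLevelCurveData.Gamma, CartanLevelCurveData.Gamma, mem_normOneUnits_iff,
    mem_normOneUnits_iff, H, H]
  have e1 : ((g * γ * g⁻¹ : GL (Fin 2) ℝ) : Matrix (Fin 2) (Fin 2) ℝ) =
      (g : Matrix (Fin 2) (Fin 2) ℝ) * γ * ((g⁻¹ : GL (Fin 2) ℝ) : Matrix (Fin 2) (Fin 2) ℝ) := by
    rw [Units.val_mul, Units.val_mul]
  have e2 : (((g * γ * g⁻¹)⁻¹ : GL (Fin 2) ℝ) : Matrix (Fin 2) (Fin 2) ℝ) =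
      (g : Matrix (Fin 2) (Fin 2) ℝ) * ((γ⁻¹ : GL (Fin 2) ℝ) : Matrix (Fin 2) (Fin 2) ℝ) *
        ((g⁻¹ : GL (Fin 2) ℝ) : Matrix (Fin 2) (Fin 2) ℝ) := by
    rw [mul_inv_rev, mul_inv_rev, inv_inv, Units.val_mul, Units.val_mul, mul_assoc]
  have e3 : Matrix.GeneralLinearGroup.det (g * γ * g⁻¹) = Matrix.GeneralLinearGroup.det γ := by
    rw [map_mul, map_mul, map_inv, mul_inv_cancel_comm]
  rw [e1, e2, e3]

include H in
/-- **The Hecke sets are conjugate**: `a ∈ ι₁(O₁(n)) ↔ g a g⁻¹ ∈ ι₂(O₂(n))`. [folklore] -/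
theorem mem_heckeSet_iff_conj (n : ℕ) (a : GL (Fin 2) ℝ) :
    a ∈ X₁.heckeSet n ↔ g * a * g⁻¹ ∈ X₂.heckeSet n := by
  change ((∃ x ∈ X₁.O, X₁.ι x = (a : Matrix (Fin 2) (Fin 2) ℝ)) ∧ (a : Matrix (Fin 2) (Fin 2) ℝ).det = n) ↔
    ((∃ x ∈ X₂.O, X₂.ι x = ((g * a * g⁻¹ : GL (Fin 2) ℝ) : Matrix (Fin 2) (Fin 2) ℝ)) ∧
      ((g * a * g⁻¹ : GL (Fin 2) ℝ) : Matrix (Fin 2) (Fin 2) ℝ).det = n)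
  rw [H, Units.val_mul, Units.val_mul, Matrix.det_units_conj]

include H in
/-- **The Hecke operators transport**: for `F₂ ∈ S₂(Γ₂)` and `F₁ = F₂ ∣[2] g ∈ S₂(Γ₁)` (`det g > 0`),
`T_n^{(1)} F₁ = (T_n^{(2)} F₂) ∣[2] g` — the coset spaces `Γ₁∖ι₁(O₁(n))` and `Γ₂∖ι₂(O₂(n))` correspond under
`a ↦ g a g⁻¹`, and the summands agree after re-choosing representatives (the forms are `Γ`-invariant). [folklore] -/
theorem heckeFun_eq_heckeFun_slash (hg : 0 < g.det.val) (F₂ : CuspForm X₂.Gamma 2) (F₁ : CuspForm X₁.Gamma 2)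
    (hF : (⇑F₁ : ℍ → ℂ) = ⇑F₂ ∣[(2 : ℤ)] g) (n : ℕ) :
    X₁.heckeFun n F₁ = (X₂.heckeFun n F₂) ∣[(2 : ℤ)] g := by
  have hΓ := conjAct_inv_smul_Gamma_eq X₁ X₂ H
  have hmemΓ : ∀ γ : GL (Fin 2) ℝ, γ ∈ X₁.Gamma ↔ g * γ * g⁻¹ ∈ X₂.Gamma := by
    intro γ
    rw [← hΓ, mem_conjAct_inv_smul_iff]
  -- the map on coset spaces
  set T : X₁.heckeSet n → X₂.heckeSet n := fun a =>
    ⟨g * (a : GL (Fin 2) ℝ) * g⁻¹, (mem_heckeSet_iff_conj X₁ X₂ H n _).mp a.2⟩ with hT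
  have hTcompat : ∀ a a' : X₁.heckeSet n, (X₁.heckeSetoid n).r a a' →
      (X₂.heckeSetoid n).r (T a) (T a') := by
    rintro a a' ⟨γ, hγ, hγa⟩
    refine ⟨g * γ * g⁻¹, (hmemΓ γ).mp hγ, ?_⟩
    change g * γ * g⁻¹ * (g * (a : GL (Fin 2) ℝ) * g⁻¹) = g * (a' : GL (Fin 2) ℝ) * g⁻¹
    rw [← hγa]
    group
  set Φ : Quotient (X₁.heckeSetoid n) → Quotient (X₂.heckeSetoid n) := Quotient.map' T hTcompat with hΦdef
  have hΦ_mk : ∀ a : X₁.heckeSet n, Φ (Quotient.mk _ a) = Quotient.mk _ (T a) := fun a => rfl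
  have hΦ : Function.Bijective Φ := by
    constructor
    · intro q₁ q₂
      induction q₁ using Quotient.inductionOn with
      | h a₁ =>
        induction q₂ using Quotient.inductionOn with
        | h a₂ =>
          intro heq
          rw [hΦ_mk, hΦ_mk] at heq
          obtain ⟨γ, hγ, hγa⟩ := Quotient.exact heq
          apply Quotient.sound
          refine ⟨g⁻¹ * γ * g, (hmemΓ _).mpr (by simpa only [← mul_assoc, mul_inv_cancel, one_mul,
            mul_inv_cancel_right] using hγ), ?_⟩
          have hγa' : γ * (g * (a₁ : GL (Fin 2) ℝ) * g⁻¹) = g * (a₂ : GL (Fin 2) ℝ) * g⁻¹ := hγa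
          calc g⁻¹ * γ * g * (a₁ : GL (Fin 2) ℝ) = g⁻¹ * (γ * (g * (a₁ : GL (Fin 2) ℝ) * g⁻¹)) * g := by group
            _ = g⁻¹ * (g * (a₂ : GL (Fin 2) ℝ) * g⁻¹) * g := by rw [hγa']
            _ = a₂ := by group
    · intro q
      induction q using Quotient.inductionOn with
      | h c =>
        have hc : g⁻¹ * (c : GL (Fin 2) ℝ) * g ∈ X₁.heckeSet n := by
          rw [mem_heckeSet_iff_conj X₁ X₂ H n]
          simpa only [← mul_assoc, mul_inv_cancel, one_mul, mul_inv_cancel_right] using c.2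
        refine ⟨Quotient.mk _ ⟨_, hc⟩, ?_⟩
        rw [hΦ_mk]
        apply Quotient.sound
        refine ⟨1, one_mem _, ?_⟩
        change 1 * (g * (g⁻¹ * (c : GL (Fin 2) ℝ) * g) * g⁻¹) = (c : GL (Fin 2) ℝ)
        group
  -- termwise comparison
  funext τ
  have hslash : ∀ h : ℍ → ℂ, (h ∣[(2 : ℤ)] g) τ = h (g • τ) * ((g.det.val : ℂ) * denom g τ ^ (-(2 : ℤ))) := by
    intro h
    rw [ModularForm.slash_apply, σ_apply_of_det_pos hg, abs_of_pos hg]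
    rw [show (2 : ℤ) - 1 = 1 by norm_num, zpow_one]
    ring
  have hterm : ∀ q₁ : Quotient (X₁.heckeSetoid n),
      (⇑F₁ ∣[(2 : ℤ)] ((q₁.out : X₁.heckeSet n) : GL (Fin 2) ℝ)) τ =
        (⇑F₂ ∣[(2 : ℤ)] (((Φ q₁).out : X₂.heckeSet n) : GL (Fin 2) ℝ)) (g • τ) *
          ((g.det.val : ℂ) * denom g τ ^ (-(2 : ℤ))) := by
    intro q₁
    -- `(Φ q₁).out = γ₂ · g q₁.out g⁻¹` with `γ₂ ∈ Γ₂`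
    have hq : Φ q₁ = Quotient.mk _ (T q₁.out) := by
      conv_lhs => rw [← Quotient.out_eq q₁]
      rfl
    obtain ⟨γ, hγ, hγeq⟩ := Quotient.exact ((Quotient.out_eq (Φ q₁)).trans hq)
    -- hγeq : γ * (Φ q₁).out = T q₁.out
    have hout : (((Φ q₁).out : X₂.heckeSet n) : GL (Fin 2) ℝ) =
        γ⁻¹ * (g * ((q₁.out : X₁.heckeSet n) : GL (Fin 2) ℝ) * g⁻¹) := by
      rw [eq_inv_mul_iff_mul_eq]
      exact hγeq
    rw [← hslash, hout, hF, ← SlashAction.slash_mul, ← SlashAction.slash_mul,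
      show γ⁻¹ * (g * ((q₁.out : X₁.heckeSet n) : GL (Fin 2) ℝ) * g⁻¹) * g =
        γ⁻¹ * (g * ((q₁.out : X₁.heckeSet n) : GL (Fin 2) ℝ)) by group,
      SlashAction.slash_mul (2 : ℤ) γ⁻¹ (g * ((q₁.out : X₁.heckeSet n) : GL (Fin 2) ℝ)) (⇑F₂ : ℍ → ℂ),
      SlashInvariantFormClass.slash_action_eq F₂ γ⁻¹ (inv_mem hγ)]
  unfold CartanLevelCurveData.heckeFun
  rw [hslash, finsum_mul]
  exact finsum_eq_of_bijective Φ hΦ hterm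

include H in
/-- **TRANSPORT OF PARAMETRISATION DATA along `τ ↦ g τ`.** If `ι₂(O₂) = g ι₁(O₁) g⁻¹` with `det g > 0`, every Cartan
parametrisation datum of `W` on `X₂` yields one on `X₁` OF THE SAME DEGREE: same lattice and uniformisation, form
`F₂ ∣[2] g ∈ S₂(Γ₁)` (`Γ₁ = g⁻¹ Γ₂ g`), base point `g⁻¹ τ₀`; then `∫_{g⁻¹τ₀}^τ (F₂ ∣[2] g) = ∫_{τ₀}^{gτ} F₂`, so the periods,
the Hecke eigenvalues (`T_n^{(1)} (F₂ ∣ g) = (T_n^{(2)} F₂) ∣ g`) and the fibres of `Γ₁ τ ↦ φ₂(g τ)` over `W(ℂ)` are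
those of the original datum read through the bijection `Γ₁∖ℍ → Γ₂∖ℍ`, `τ ↦ g τ`. [folklore] -/
theorem exists_cartanParametrizationData_deg_eq (hg : 0 < g.det.val) {W : WeierstrassCurve ℚ}
    (Q : CartanParametrizationData X₂ W) : ∃ Q' : CartanParametrizationData X₁ W, Q'.deg = Q.deg := by
  have hΓ := conjAct_inv_smul_Gamma_eq X₁ X₂ H
  obtain ⟨F, hF⟩ := exists_cuspForm_coe_eq_of_level_eq hΓ (CuspForm.translate Q.form g)
  have hF' : (⇑F : ℍ → ℂ) = ⇑Q.form ∣[(2 : ℤ)] g := by rw [hF]; rfl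
  have hseg : ∀ τ : ℍ, segmentIntegral F (g⁻¹ • Q.basePoint) τ = segmentIntegral Q.form Q.basePoint (g • τ) := by
    intro τ
    rw [hF', segmentIntegral_slash_inv_smul Q.form hg]
  refine ⟨{ L := Q.L
            isNeronLattice := Q.isNeronLattice
            uniformize := Q.uniformize
            ker_uniformize := Q.ker_uniformize
            uniformize_surjective := Q.uniformize_surjective
            uniformize_spec := Q.uniformize_spec
            form := F
            basePoint := g⁻¹ • Q.basePoint
            period_mem := ?_
            hecke_eq := ?_
            deg := Q.deg
            deg_pos := Q.deg_pos
            deg_spec := ?_ }, rfl⟩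
  · rw [hF']
    exact hasPeriodsIn_slash_of_conjAct_eq hΓ Q.form hg Q.period_mem
  · intro ℓ hℓ hnd
    rw [heckeFun_eq_heckeFun_slash X₁ X₂ H hg Q.form F hF' ℓ, Q.hecke_eq ℓ hℓ hnd,
      show (fun τ => ((W.LFunction ℓ : ℤ) : ℂ) * Q.form τ) = ((W.LFunction ℓ : ℤ) : ℂ) • (⇑Q.form : ℍ → ℂ) from rfl,
      smul_slash_of_det_pos hg, ← hF']
    rfl
  · convert Q.deg_spec using 3
    rw [card_orbitFibre_eq_of_conjAct_eq hΓ (fun τ => Q.uniformize (segmentIntegral Q.form Q.basePoint τ))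
      (fun τ => Q.uniformize (segmentIntegral F (g⁻¹ • Q.basePoint) τ)) (fun τ => by simp only [hseg])]

end Transport


end Summit.BirchSwinnertonDyer.BirchSwinnertonDyer.Theorems.CartanDegree

end
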